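import Summits.Ventures.PercRepro.C041CutSplitSum
import Summits.Ventures.PercRepro.C041CutGlueLayers

/-!
# LEMMA G for a layered loose problem: the O-cube sum is the glue of the layered gadget with the common far side
(p6, gen 25; C-041.md §9, §10 (a))

The abstract shape of mine-3's LEMMA G: an O-cube is a family of single-layer problems `L i` (one per opening
`X ⊆ B(O)`, `i` ranging over the layers), each split at the SAME cut vertex, with the SAME far side (`B(O)` lies on the
gadget side, so `Γ″` is untouched by the openings — in Lean: the far sides are identified by equivalences `e i` of
their terminal edges under which their far spaces are one fixed space `Q`).  Then

  **`sum_phiOr_eq_glue`**: `Σ_i Φ∨(L i) = Φ(glue (sigmaSpace gadget) ρ₁ ρ₂ Q)`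

— the per-layer pairings `phiOr_eq_glue`, transported along `e i` (`phi_glue_map`: the weight sum of a glue does
not see a renaming of the far states), summed by `phi_glue_sigma`.  Hence the bound, LEMMA G and the (INV) form
hold for the O-cube sum (`sum_phiOr_ge`, `sum_phiOr_nonneg_of_star`, `sum_phiOr_ge_of_INV`) with the layered
gadget's counts.  What a skeleton-level O-cube must supply to use this: the family `L i`, the splits and the
identification of the far sides — not typed.
-/

namespace PercRepro

namespace CutGlue

variable {X X' : Type*}

/-- Transport of a space along an equivalence of its states. -/
def Space.map (f : X ≃ X') (Q : Space X) : Space X' where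
  w x' := Q.w (f.symm x')
  G₁ x' := Q.G₁ (f.symm x')
  G₂ x' := Q.G₂ (f.symm x')
  V x' := Q.V (f.symm x')
  hG₁ _ h := Q.hG₁ _ h
  hG₂ _ h := Q.hG₂ _ h

variable [Fintype X] [Fintype X']

open Classical in
/-- `Φ` does not see a renaming of the states. -/
theorem Space.phi_map (f : X ≃ X') (Q : Space X) : (Q.map f).phi = Q.phi := by
  unfold Space.phi
  refine (Fintype.sum_equiv f _ _ fun x => ?_).symm
  simp [Space.map, Space.wt]

open Classical in
/-- A weighted count does not see a renaming of the states. -/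
theorem Space.cnt_map (f : X ≃ X') (Q : Space X) (p : X' → Prop) :
    (Q.map f).cnt p = Q.cnt fun x => p (f x) := by
  unfold Space.cnt
  refine (Fintype.sum_equiv f _ _ fun x => ?_).symm
  simp [Space.map]

/-- `N` does not see a renaming of the states. -/
theorem Space.N_map (f : X ≃ X') (Q : Space X) : (Q.map f).N = Q.N := by
  unfold Space.N
  rw [Space.cnt_map]

/-- `NV` does not see a renaming of the states. -/
theorem Space.NV_map (f : X ≃ X') (Q : Space X) : (Q.map f).NV = Q.NV := by
  unfold Space.NV
  rw [Space.cnt_map]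
  apply Q.cnt_congr
  intro x
  simp [Space.map]

/-- `NnotV` does not see a renaming of the states. -/
theorem Space.NnotV_map (f : X ≃ X') (Q : Space X) : (Q.map f).NnotV = Q.NnotV := by
  unfold Space.NnotV
  rw [Space.cnt_map]
  apply Q.cnt_congr
  intro x
  simp [Space.map]

variable {Y : Type*} [Fintype Y]

open Classical in
/-- The weight sum of a glue does not see a renaming of the far states. -/
theorem phi_glue_map (P : Space Y) (ρ₁ ρ₂ : Y → Prop) (f : X ≃ X') (Q : Space X) :
    (glue P ρ₁ ρ₂ (Q.map f)).phi = (glue P ρ₁ ρ₂ Q).phi := by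
  unfold Space.phi
  refine (Fintype.sum_equiv (Equiv.prodCongr (Equiv.refl Y) f) _ _ fun s => ?_).symm
  simp [glue, Space.map, Space.wt]

end CutGlue

namespace ZonePort

namespace Loose

open CutGlue

variable {ι V E : Type*} [Fintype ι] [Fintype E] [DecidableEq E] [DecidableEq V]
  {T : Type*} [Fintype T] [DecidableEq T]

/-- The renaming of far-side patterns induced by a renaming of the far-side terminal edges. -/
def farEquiv {L : Loose V E} (sp : L.Split) (e : sp.Term₂ ≃ T) : (sp.Term₂ → Bool) ≃ (T → Bool) :=
  Equiv.arrowCongr e (Equiv.refl Bool)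

open Classical in
/-- **THE O-CUBE SUM IS THE GLUE OF THE LAYERED GADGET WITH THE COMMON FAR SIDE** (C-041.md §9): for a family of
loose problems `L i` with splits `sp i` whose far sides are one space `Q` under the renamings `e i`,
`Σ_i Φ∨(L i) = Φ(glue (sigmaSpace gadget) ρ₁ ρ₂ Q)`. -/
theorem sum_phiOr_eq_glue (L : ι → Loose V E) (sp : (i : ι) → (L i).Split) (e : (i : ι) → (sp i).Term₂ ≃ T)
    (Q : Space (T → Bool)) (hfar : ∀ i, ((sp i).far).map (farEquiv (sp i) (e i)) = Q) :
    ∑ i, (L i).phiOr = (glue (sigmaSpace fun i => (sp i).gadget) (sigmaRho fun i => (sp i).ρ₁)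
      (sigmaRho fun i => (sp i).ρ₂) Q).phi := by
  rw [phi_glue_sigma]
  apply Finset.sum_congr rfl
  intro i _
  rw [(sp i).phiOr_eq_glue, ← hfar i, phi_glue_map]

open Classical in
/-- **THE BOUND OF LEMMA G FOR THE O-CUBE SUM**: with `α ≤ m_t` of the layered gadget (the sum over the layers of
the per-layer `m_t`), `Σ_i Φ∨(L i) ≥ α·Φ(Q) + (Φ_all(gadget) + 2α)·NV(Q) + Φ(gadget)·NnotV(Q)`. -/
theorem sum_phiOr_ge (L : ι → Loose V E) (sp : (i : ι) → (L i).Split) (e : (i : ι) → (sp i).Term₂ ≃ T)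
    (Q : Space (T → Bool)) (hfar : ∀ i, ((sp i).far).map (farEquiv (sp i) (e i)) = Q) {α : ℤ}
    (h₁ : α ≤ (sigmaSpace fun i => (sp i).gadget).m₁ (sigmaRho fun i => (sp i).ρ₁))
    (h₂ : α ≤ (sigmaSpace fun i => (sp i).gadget).m₂ (sigmaRho fun i => (sp i).ρ₂)) :
    α * Q.phi + ((sigmaSpace fun i => (sp i).gadget).phiAll + 2 * α) * Q.NV
      + (sigmaSpace fun i => (sp i).gadget).phi * Q.NnotV ≤ ∑ i, (L i).phiOr := by
  rw [sum_phiOr_eq_glue L sp e Q hfar]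
  exact phi_glue_ge _ _ _ Q h₁ h₂

open Classical in
/-- **LEMMA G FOR THE O-CUBE SUM**: (O-CUBE) on the layered gadget (`Σ_i Φ(gadget i) ≥ 0`), `Φ(Q) ≥ 0` and the
criterion (★) for the layered gadget give `Σ_i Φ∨(L i) ≥ 0`. -/
theorem sum_phiOr_nonneg_of_star (L : ι → Loose V E) (sp : (i : ι) → (L i).Split)
    (e : (i : ι) → (sp i).Term₂ ≃ T) (Q : Space (T → Bool))
    (hfar : ∀ i, ((sp i).far).map (farEquiv (sp i) (e i)) = Q)
    (hP : 0 ≤ ∑ i, ((sp i).gadget).phi) (hQ : 0 ≤ Q.phi)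
    (hstar : 0 ≤ (sigmaSpace fun i => (sp i).gadget).phiAll + 2 * min
      ((sigmaSpace fun i => (sp i).gadget).m₁ (sigmaRho fun i => (sp i).ρ₁))
      ((sigmaSpace fun i => (sp i).gadget).m₂ (sigmaRho fun i => (sp i).ρ₂))) :
    0 ≤ ∑ i, (L i).phiOr := by
  rw [sum_phiOr_eq_glue L sp e Q hfar]
  refine phi_glue_nonneg_of_star _ _ _ Q ?_ hQ hstar
  rw [phi_sigma]
  exact hP

open Classical in
/-- **THE (INV) FORM FOR THE O-CUBE SUM** (C-041.md §10 (a)): with (INV) for the layered gadget,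
`Σ_i Φ∨(L i) ≥ I(gadget)·Φ(Q) + Φ(gadget)·N(Q)`. -/
theorem sum_phiOr_ge_of_INV (L : ι → Loose V E) (sp : (i : ι) → (L i).Split)
    (e : (i : ι) → (sp i).Term₂ ≃ T) (Q : Space (T → Bool))
    (hfar : ∀ i, ((sp i).far).map (farEquiv (sp i) (e i)) = Q)
    (hI₁ : (sigmaSpace fun i => (sp i).gadget).I ≤
      (sigmaSpace fun i => (sp i).gadget).m₁ (sigmaRho fun i => (sp i).ρ₁))
    (hI₂ : (sigmaSpace fun i => (sp i).gadget).I ≤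
      (sigmaSpace fun i => (sp i).gadget).m₂ (sigmaRho fun i => (sp i).ρ₂)) :
    (sigmaSpace fun i => (sp i).gadget).I * Q.phi + (sigmaSpace fun i => (sp i).gadget).phi * Q.N
      ≤ ∑ i, (L i).phiOr := by
  rw [sum_phiOr_eq_glue L sp e Q hfar]
  exact phi_glue_ge_of_INV _ _ _ Q hI₁ hI₂

end Loose

end ZonePort

end PercRepro
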